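import Literature.Analysis.FluidPDE.OseenSlice
import HarnessLib

/-!
# The far-field bound of the Oseen slice operator

Analysis/FluidPDE support file (everything proved; no definitions, no named facts). For the
Oseen slice operator `N_σ[a, b](x) = ∫ K(σ, x − y)[a(y), b(y)] dy` of `OseenSlice.lean`
(`e^{σΔ} P ∇·(a ⊗ b)` for a rank-one tensor field), the contribution of sources at distance `≥ r`
from `x` is bounded UNIFORMLY IN `σ`:

  `‖N_σ[a, b](x)‖ ≤ C₁ M_a M_b / r`   if `a(y) = 0` or `b(y) = 0` whenever `‖x − y‖ < r`

(`exists_norm_oseenSlice_le_of_far`): Koch–Tataru's envelope `|K(σ, z)| ≲ (σ + |z|²)^{-(d+1)/2}`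
(their (14)) is at most `2^{(d+1)/2} (r² + |z|²)^{-(d+1)/2}` off the ball of radius `r`, whose
total mass is `r⁻¹ ∫ (1 + |w|²)^{-(d+1)/2} dw` by parabolic scaling
(`integral_add_norm_sq_rpow_neg_half_succ` with `σ ↦ r²`). Integrated in time this is the
far-field part `≲ M² t/r` of the Duhamel term, against `≲ M² √t` for the whole of it
(`exists_norm_oseenSlice_le`). Used in `Summits/NavierStokesRegularity`
(route `LevelSetModeration`, item `HighSpeedPressureWork`) to localise the sources of the Duhamel
term at a fast point.

## References

* H. Koch, D. Tataru, *Well-posedness for the Navier–Stokes equations*, Adv. Math. 157 (2001),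
  §2 (8) and §3 (14). [cite: KochTataruAdvMath2001, §3 (14)]
-/

noncomputable section

open MeasureTheory Set Function Filter Metric Real
open _root_.Topology
open scoped ENNReal NNReal RealInnerProductSpace

namespace Literature.Analysis.FluidPDE

variable {E : Type*} [NormedAddCommGroup E] [InnerProductSpace ℝ E] [FiniteDimensional ℝ E]
  [MeasurableSpace E] [BorelSpace E]

/-- **Far-field bound of the Oseen slice operator**: there is `C₁ = C₁(E) > 0` such that for
`σ > 0`, fields with `‖a‖ ≤ M_a`, `‖b‖ ≤ M_b`, a point `x` and a radius `r > 0` with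
`a(y) = 0 ∨ b(y) = 0` for all `y` with `‖x − y‖ < r` (no source within distance `r` of `x`),
`‖N_σ[a, b](x)‖ ≤ C₁ M_a M_b / r`, uniformly in `σ` (envelope comparison off the ball and the
scaling of `∫ (r² + |z|²)^{-(d+1)/2} dz = r⁻¹ ∫ (1 + |w|²)^{-(d+1)/2} dw`).
[cite: KochTataruAdvMath2001, §3 (14)] -/
theorem exists_norm_oseenSlice_le_of_far :
    ∃ C₁ : ℝ, 0 < C₁ ∧ ∀ {σ : ℝ}, 0 < σ → ∀ {a b : E → E} {Ma Mb : ℝ},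
      (∀ y, ‖a y‖ ≤ Ma) → (∀ y, ‖b y‖ ≤ Mb) → ∀ {x : E} {r : ℝ}, 0 < r →
      (∀ y, ‖x - y‖ < r → a y = 0 ∨ b y = 0) →
        ‖oseenSlice σ a b x‖ ≤ C₁ * Ma * Mb / r := by
  obtain ⟨C, hC, hK⟩ := exists_norm_oseenKernel_le (E := E)
  set p : ℝ := ((Module.finrank ℝ E : ℝ) + 1) / 2 with hp
  have hp0 : 0 < p := by rw [hp]; positivity
  set I : ℝ := ∫ w : E, (1 + ‖w‖ ^ 2) ^ (-p) with hI
  have hI0 : 0 < I := integral_one_add_norm_sq_rpow_neg_pos (by rw [hp]; linarith)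
  refine ⟨C * 2 ^ p * I, by positivity, fun {σ} hσ {a b Ma Mb} ha hb {x r} hr hfar => ?_⟩
  have hMa : 0 ≤ Ma := (norm_nonneg _).trans (ha x)
  have hMb : 0 ≤ Mb := (norm_nonneg _).trans (hb x)
  have hr2 : 0 < r ^ 2 := by positivity
  -- the majorant
  set g : E → ℝ := fun y => C * Ma * Mb * 2 ^ p * (r ^ 2 + ‖x - y‖ ^ 2) ^ (-p) with hg
  have hgi : Integrable g := by
    have h1 := (integrable_add_norm_sq_rpow_neg_half_succ (E := E) hr2).comp_sub_left x
    have : g = fun y => C * Ma * Mb * 2 ^ p * (fun z : E => (r ^ 2 + ‖z‖ ^ 2) ^ (-p)) (x - y) := by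
      funext y; simp only [hg, hp]
    rw [this]
    exact h1.const_mul _
  -- pointwise domination
  have hdom : ∀ y, ‖oseenKernel σ (x - y) (a y) (b y)‖ ≤ g y := by
    intro y
    have hgy : 0 ≤ g y := by
      simp only [hg]
      exact mul_nonneg (by positivity) (Real.rpow_nonneg (by positivity) _)
    by_cases hy : ‖x - y‖ < r
    · rcases hfar y hy with h0 | h0
      · rw [h0, oseenKernel_zero_left, norm_zero]; exact hgy
      · rw [h0, oseenKernel_zero_right, norm_zero]; exact hgy
    · rw [not_lt] at hy
      have hy2 : r ^ 2 ≤ ‖x - y‖ ^ 2 := pow_le_pow_left₀ hr.le hy 2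
      have hpos : 0 < ‖x - y‖ ^ 2 := hr2.trans_le hy2
      -- envelope comparison `(σ + |z|²)^{-p} ≤ (|z|²)^{-p} ≤ 2^p (r² + |z|²)^{-p}`
      have h1 : (σ + ‖x - y‖ ^ 2) ^ (-p) ≤ ((r ^ 2 + ‖x - y‖ ^ 2) / 2) ^ (-p) :=
        Real.rpow_le_rpow_of_nonpos (by positivity) (by linarith) (by linarith)
      have h2 : ((r ^ 2 + ‖x - y‖ ^ 2) / 2) ^ (-p) = 2 ^ p * (r ^ 2 + ‖x - y‖ ^ 2) ^ (-p) := by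
        rw [Real.div_rpow (by positivity) (by norm_num), Real.rpow_neg (by norm_num : (0:ℝ) ≤ 2),
          div_eq_mul_inv, inv_inv, mul_comm]
      have h3 := hK hσ (x - y) (a y) (b y)
      calc ‖oseenKernel σ (x - y) (a y) (b y)‖
          ≤ C * (σ + ‖x - y‖ ^ 2) ^ (-p) * ‖a y‖ * ‖b y‖ := h3
        _ ≤ C * (2 ^ p * (r ^ 2 + ‖x - y‖ ^ 2) ^ (-p)) * Ma * Mb := by
            have hw : 0 ≤ C * (2 ^ p * (r ^ 2 + ‖x - y‖ ^ 2) ^ (-p)) :=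
              mul_nonneg hC.le (mul_nonneg (by positivity) (Real.rpow_nonneg (by positivity) _))
            have hw' : C * (σ + ‖x - y‖ ^ 2) ^ (-p) ≤ C * (2 ^ p * (r ^ 2 + ‖x - y‖ ^ 2) ^ (-p)) :=
              mul_le_mul_of_nonneg_left (h1.trans (le_of_eq h2)) hC.le
            exact mul_le_mul (mul_le_mul hw' (ha y) (norm_nonneg _) hw) (hb y) (norm_nonneg _)
              (mul_nonneg hw hMa)
        _ = g y := by simp only [hg]; ring
  -- integrate
  rw [oseenSlice_apply]
  refine (norm_integral_le_of_norm_le hgi (Eventually.of_forall hdom)).trans (le_of_eq ?_)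
  have hval : ∫ y, g y = C * Ma * Mb * 2 ^ p * ((r ^ 2) ^ (-(1 / 2 : ℝ)) * I) := by
    simp only [hg]
    rw [integral_const_mul]
    congr 1
    have hsub := integral_sub_left_eq_self (fun z : E => (r ^ 2 + ‖z‖ ^ 2) ^ (-p)) volume x
    rw [hsub, hp, integral_add_norm_sq_rpow_neg_half_succ hr2]
  rw [hval]
  have hr' : (r ^ 2) ^ (-(1 / 2 : ℝ)) = r⁻¹ := by
    rw [Real.rpow_neg hr2.le, ← Real.sqrt_eq_rpow, Real.sqrt_sq hr.le]
  rw [hr']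
  field_simp

/-- Far-field bound, left-slot form: if `a` vanishes on the ball `B(x, r)` then
`‖N_σ[a, b](x)‖ ≤ C₁ M_a M_b / r`. [cite: KochTataruAdvMath2001, §3 (14)] -/
theorem exists_norm_oseenSlice_le_of_far_left :
    ∃ C₁ : ℝ, 0 < C₁ ∧ ∀ {σ : ℝ}, 0 < σ → ∀ {a b : E → E} {Ma Mb : ℝ},
      (∀ y, ‖a y‖ ≤ Ma) → (∀ y, ‖b y‖ ≤ Mb) → ∀ {x : E} {r : ℝ}, 0 < r →
      (∀ y, ‖x - y‖ < r → a y = 0) → ‖oseenSlice σ a b x‖ ≤ C₁ * Ma * Mb / r := by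
  obtain ⟨C₁, hC₁, h⟩ := exists_norm_oseenSlice_le_of_far (E := E)
  exact ⟨C₁, hC₁, fun hσ _ _ _ _ ha hb _ _ hr hfar => h hσ ha hb hr fun y hy => Or.inl (hfar y hy)⟩

/-- Far-field bound, right-slot form: if `b` vanishes on the ball `B(x, r)` then
`‖N_σ[a, b](x)‖ ≤ C₁ M_a M_b / r`. [cite: KochTataruAdvMath2001, §3 (14)] -/
theorem exists_norm_oseenSlice_le_of_far_right :
    ∃ C₁ : ℝ, 0 < C₁ ∧ ∀ {σ : ℝ}, 0 < σ → ∀ {a b : E → E} {Ma Mb : ℝ},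
      (∀ y, ‖a y‖ ≤ Ma) → (∀ y, ‖b y‖ ≤ Mb) → ∀ {x : E} {r : ℝ}, 0 < r →
      (∀ y, ‖x - y‖ < r → b y = 0) → ‖oseenSlice σ a b x‖ ≤ C₁ * Ma * Mb / r := by
  obtain ⟨C₁, hC₁, h⟩ := exists_norm_oseenSlice_le_of_far (E := E)
  exact ⟨C₁, hC₁, fun hσ _ _ _ _ ha hb _ _ hr hfar => h hσ ha hb hr fun y hy => Or.inr (hfar y hy)⟩

end Literature.Analysis.FluidPDE

end
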